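import Mathlib
import HarnessLib.Audit
import Summits.PneNP.PneNP.Theorems.PstarGateNodesX
import Summits.PneNP.PneNP.Theorems.PstarGateCasePNorHolders

/-!
# One GATED chord: the expansion BUDGET of the core — tree edges beyond the chords must be private (E2; prover-1 g19)

FRONTIER range-avoidance ladder, rung F-N3 (`stmt-PneNP-19007`), cell `pnp-ideate` (`PstarGateNodesX`, nodes N2–N4); restricted-model proof
complexity — nothing here bears on `P` versus `NP`.

One-gate bridge data on an XOR-closed core (`GateDataX`), any chord set `N ∋ e`.  Boundary count on `X = J₀ ∪ {g₀}` (`#X ≤ r`): XOR slots of core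
outputs are inner, `p` is held by `e` and `g₀`, `u` by `g₀` and a tree edge; so `g₀` pays at most `2` boundary variables, `e` at most `1`, every
other chord at most `2`, a tree edge at most `2` and at most `1` unless it is PRIVATE (both AND variables unread by every other output of `X`).
`(r, 3/2)`-expansion then reads

* `gate_budget` — **`#(J₀ ∖ N) + 1 ≤ #N + 2 · #{private tree edges}`** (generalising `PstarGateU2Budget.u2_budget`, the case `#N = 2`).
-/

set_option linter.dupNamespace false -- `Summit.PneNP.PneNP.…`: summit = sub-problem name (D-0017 single-conjunct layout)

open Finset Literature.Computability.Complexity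
open Summit.PneNP.PneNP.Theorems.PstarSALevel (varSet bdry BoundaryExpanding SimpleOverlap)
open Summit.PneNP.PneNP.Theorems.PstarCentreFree (vars_mem_varSet)
open Summit.PneNP.PneNP.Theorems.PstarXCore (xverts)
open Summit.PneNP.PneNP.Theorems.PstarCoreBound (XorClosed)
open Summit.PneNP.PneNP.Theorems.PstarChordSystem (ChordSystem)
open Summit.PneNP.PneNP.Theorems.PstarChordBridgeTools (privs coef)
open Summit.PneNP.PneNP.Theorems.PstarChordBridge (BridgeData sys Solution Lift)
open Summit.PneNP.PneNP.Theorems.PstarNorCoreTools (not_mem_bdry_of_two card_varSet_inter_bdry_le card_bdry_le_sum)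
open Summit.PneNP.PneNP.Theorems.PstarGateBridge (GateHyp)
open Summit.PneNP.PneNP.Theorems.PstarGateCasePNorHolders (not_mem_bdry_of_closed card_three_slots)
open Summit.PneNP.PneNP.Theorems.PstarGateNodes (GateData)
open Summit.PneNP.PneNP.Theorems.PstarGateNodesX (GateDataX)

namespace Summit.PneNP.PneNP.Theorems.PstarGateBudget

variable {n m : ℕ}

/-- **The one-gate budget.**  See the module docstring. -/
theorem gate_budget (I : LocalMap 4 n m) {r₀ : ℕ} (hB : BoundaryExpanding r₀ I) {B : BridgeData n m} {e g₀ : Fin m}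
    {u : Fin n} {κ₀ : ZMod 2} (hD : GateDataX I r₀ B e g₀ u κ₀) :
    ∃ Pv ⊆ B.J₀ \ B.N,
      (∀ j ∈ Pv, ∀ j' ∈ insert g₀ B.J₀, j' ≠ j → I.vars j 2 ∉ varSet I j' ∧ I.vars j 3 ∉ varSet I j') ∧
      (B.J₀ \ B.N).card + 1 ≤ B.N.card + 2 * Pv.card := by
  classical
  obtain ⟨hXc, hW, hr, hd₁, -, -, -, -, hG, hg₀, hgv, hju, -⟩ := id hD
  have he : e ∈ B.N := hG.1
  have heJ : e ∈ B.J₀ := hW.hN he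
  have hg₀J : g₀ ∉ B.J₀ := fun h => disjoint_left.1 hd₁ hg₀ h
  set F := B.J₀ \ B.N with hFdef
  have hFJ : F ⊆ B.J₀ := sdiff_subset
  set X : Finset (Fin m) := insert g₀ B.J₀ with hXdef
  set Pv := F.filter (fun j => ∀ j' ∈ X, j' ≠ j → I.vars j 2 ∉ varSet I j' ∧ I.vars j 3 ∉ varSet I j') with hPv
  refine ⟨Pv, filter_subset _ _, fun j hj => (mem_filter.1 hj).2, ?_⟩
  have hJX : B.J₀ ⊆ X := subset_insert _ _
  have hg₀X : g₀ ∈ X := mem_insert_self _ _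
  have hXr : X.card ≤ r₀ :=
    (card_le_card (insert_subset (mem_union_left _ (mem_union_right _ hg₀)) (subset_union_left.trans subset_union_left))).trans hr
  have hXcard : X.card = B.J₀.card + 1 := by rw [hXdef, card_insert_of_notMem hg₀J]
  obtain ⟨jᵤ, hjᵤF, hjᵤu⟩ := hju
  have hu_jᵤ : u ∈ varSet I jᵤ := by rcases hjᵤu with h | h <;> rw [h] <;> exact vars_mem_varSet I jᵤ _
  have hp_g₀ : I.vars e 2 ∈ varSet I g₀ := by
    rcases hgv with ⟨h2, -⟩ | ⟨-, h3⟩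
    · exact h2 ▸ vars_mem_varSet I g₀ 2
    · exact h3 ▸ vars_mem_varSet I g₀ 3
  -- per-output budgets
  let q : Fin m → ℕ := fun k => if k = g₀ then 2 else if k ∈ B.N.erase e then 2 else if k ∈ Pv then 2 else 1
  have htwo : ∀ k ∈ X, k ∈ B.J₀ → (varSet I k ∩ bdry I X).card ≤ 2 := by
    intro k hk hkJ
    have h := card_varSet_inter_bdry_le I X k {0, 1} (fun s hs => by
      simp only [mem_insert, mem_singleton] at hs
      rcases hs with rfl | rfl
      · exact not_mem_bdry_of_closed I hXc hJX hkJ (by decide)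
      · exact not_mem_bdry_of_closed I hXc hJX hkJ (by decide))
    have h2 : ({0, 1} : Finset (Fin 4)).card = 2 := by decide
    rw [h2] at h; exact h
  have hq : ∀ k ∈ X, (varSet I k ∩ bdry I X).card ≤ q k := by
    intro k hk
    by_cases hkg₀ : k = g₀
    · subst hkg₀
      simp only [q, if_true]
      have h := card_varSet_inter_bdry_le I X k {2, 3} (fun s hs => by
        simp only [mem_insert, mem_singleton] at hs
        rcases hs with rfl | rfl
        · rcases hgv with ⟨h2, -⟩ | ⟨h2, -⟩
          · exact not_mem_bdry_of_two I hk (hJX heJ) (fun h => hg₀J (h ▸ heJ)) (vars_mem_varSet I k 2) (h2 ▸ vars_mem_varSet I e 2)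
          · exact not_mem_bdry_of_two I hk (hJX (hFJ hjᵤF)) (fun h => hg₀J (h ▸ hFJ hjᵤF)) (vars_mem_varSet I k 2) (h2 ▸ hu_jᵤ)
        · rcases hgv with ⟨-, h3⟩ | ⟨-, h3⟩
          · exact not_mem_bdry_of_two I hk (hJX (hFJ hjᵤF)) (fun h => hg₀J (h ▸ hFJ hjᵤF)) (vars_mem_varSet I k 3) (h3 ▸ hu_jᵤ)
          · exact not_mem_bdry_of_two I hk (hJX heJ) (fun h => hg₀J (h ▸ heJ)) (vars_mem_varSet I k 3) (h3 ▸ vars_mem_varSet I e 2))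
      have h2 : ({2, 3} : Finset (Fin 4)).card = 2 := by decide
      rw [h2] at h; exact h
    have hkJ : k ∈ B.J₀ := by
      rw [hXdef, mem_insert] at hk
      rcases hk with h | h
      · exact absurd h hkg₀
      · exact h
    by_cases hkN : k ∈ B.N.erase e
    · simp only [q, if_neg hkg₀, if_pos hkN]
      exact htwo k hk hkJ
    by_cases hkP : k ∈ Pv
    · simp only [q, if_neg hkg₀, if_neg hkN, if_pos hkP]
      exact htwo k hk hkJ
    · simp only [q, if_neg hkg₀, if_neg hkN, if_neg hkP]
      -- `e`, or a non-private tree edge: one AND slot held elsewhere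
      obtain ⟨s, hs2, k', hk', hne', hv⟩ : ∃ s : Fin 4, 2 ≤ s.val ∧ ∃ k' ∈ X, k' ≠ k ∧ I.vars k s ∈ varSet I k' := by
        by_cases hke : k = e
        · subst hke
          exact ⟨2, by decide, g₀, hg₀X, fun h => hg₀J (h ▸ heJ), hp_g₀⟩
        have hkF : k ∈ F := mem_sdiff.2 ⟨hkJ, fun hkN' => hkN (mem_erase.2 ⟨hke, hkN'⟩)⟩
        have hnp : ¬ ∀ j' ∈ X, j' ≠ k → I.vars k 2 ∉ varSet I j' ∧ I.vars k 3 ∉ varSet I j' :=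
          fun h => hkP (mem_filter.2 ⟨hkF, h⟩)
        push Not at hnp
        obtain ⟨j', hj'X, hj'k, hj'⟩ := hnp
        by_cases h2 : I.vars k 2 ∈ varSet I j'
        · exact ⟨2, by decide, j', hj'X, hj'k, h2⟩
        · exact ⟨3, by decide, j', hj'X, hj'k, hj' h2⟩
      have h := card_varSet_inter_bdry_le I X k {0, 1, s} (fun s' hs' => by
        simp only [mem_insert, mem_singleton] at hs'
        rcases hs' with rfl | rfl | rfl
        · exact not_mem_bdry_of_closed I hXc hJX hkJ (by decide)
        · exact not_mem_bdry_of_closed I hXc hJX hkJ (by decide)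
        · exact not_mem_bdry_of_two I hk hk' (Ne.symm hne') (vars_mem_varSet I k s') hv)
      rw [card_three_slots hs2] at h
      exact h
  have hbd := card_bdry_le_sum I X q hq
  -- evaluate the sum over `J₀ = N ⊔ F`
  have hqg₀ : q g₀ = 2 := by
    show (if g₀ = g₀ then 2 else if g₀ ∈ B.N.erase e then 2 else if g₀ ∈ Pv then 2 else 1) = 2
    rw [if_pos rfl]
  have hJsplit : B.J₀ = B.N ∪ F := by rw [hFdef, union_sdiff_of_subset hW.hN]
  have hdisj : Disjoint B.N F := by rw [hFdef]; exact disjoint_sdiff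
  have hsumN : ∑ k ∈ B.N, q k = 1 + 2 * (B.N.erase e).card := by
    rw [← add_sum_erase B.N q he]
    have heg₀ : e ≠ g₀ := fun h => hg₀J (h ▸ heJ)
    have heP : e ∉ Pv := fun h => (mem_sdiff.1 (mem_filter.1 h).1).2 he
    have hqe : q e = 1 := by
      show (if e = g₀ then 2 else if e ∈ B.N.erase e then 2 else if e ∈ Pv then 2 else 1) = 1
      rw [if_neg heg₀, if_neg (notMem_erase e B.N), if_neg heP]
    rw [hqe, mul_comm, card_eq_sum_ones, sum_mul]
    congr 1
    refine sum_congr rfl fun k hk => ?_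
    have hkJ : k ∈ B.J₀ := hW.hN (mem_of_mem_erase hk)
    have hkg₀ : k ≠ g₀ := fun h => hg₀J (h ▸ hkJ)
    show (if k = g₀ then 2 else if k ∈ B.N.erase e then 2 else if k ∈ Pv then 2 else 1) = 1 * 2
    rw [if_neg hkg₀, if_pos hk, one_mul]
  have hsumF : ∑ k ∈ F, q k = F.card + Pv.card := by
    have hsplit := (sum_filter_add_sum_filter_not F (fun k => k ∈ Pv) q).symm
    have hf1 : F.filter (fun k => k ∈ Pv) = Pv := by
      ext k
      simp only [mem_filter]
      exact ⟨fun h => h.2, fun h => ⟨(mem_filter.1 h).1, h⟩⟩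
    rw [hsplit, hf1]
    have h1 : ∑ k ∈ Pv, q k = 2 * Pv.card := by
      rw [mul_comm, card_eq_sum_ones, sum_mul]
      refine sum_congr rfl fun k hk => ?_
      have hkF := (mem_filter.1 hk).1
      have hkg₀ : k ≠ g₀ := fun h => hg₀J (h ▸ hFJ hkF)
      have hkN : k ∉ B.N.erase e := fun h => (mem_sdiff.1 hkF).2 (mem_of_mem_erase h)
      show (if k = g₀ then 2 else if k ∈ B.N.erase e then 2 else if k ∈ Pv then 2 else 1) = 1 * 2
      rw [if_neg hkg₀, if_neg hkN, if_pos hk, one_mul]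
    have h2 : ∑ k ∈ F.filter (fun k => k ∉ Pv), q k = (F.filter (fun k => k ∉ Pv)).card := by
      rw [card_eq_sum_ones]
      refine sum_congr rfl fun k hk => ?_
      obtain ⟨hkF, hkP⟩ := mem_filter.1 hk
      have hkg₀ : k ≠ g₀ := fun h => hg₀J (h ▸ hFJ hkF)
      have hkN : k ∉ B.N.erase e := fun h => (mem_sdiff.1 hkF).2 (mem_of_mem_erase h)
      show (if k = g₀ then 2 else if k ∈ B.N.erase e then 2 else if k ∈ Pv then 2 else 1) = 1
      rw [if_neg hkg₀, if_neg hkN, if_neg hkP]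
    rw [h1, h2]
    have hc := card_filter_add_card_filter_not (s := F) (fun k => k ∈ Pv)
    rw [hf1] at hc
    omega
  have hsumX : ∑ k ∈ X, q k = 2 + ((1 + 2 * (B.N.erase e).card) + (F.card + Pv.card)) := by
    rw [hXdef, sum_insert hg₀J, hqg₀, hJsplit, sum_union hdisj, hsumN, hsumF]
  have hexp := hB X hXr
  rw [hXcard] at hexp
  rw [hsumX, card_erase_of_mem he] at hbd
  have hJcard : B.J₀.card = B.N.card + F.card := by rw [hJsplit, card_union_of_disjoint hdisj]
  have hNpos : 1 ≤ B.N.card := card_pos.2 ⟨e, he⟩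
  omega

end Summit.PneNP.PneNP.Theorems.PstarGateBudget
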